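import Literature.MathematicalPhysics.QuantumFieldTheory.Balaban1983to89.B8LeafModelZd3SourceBounded

/-!
# `Balaban1983to89.B8LeafModelZd3H` — NODE 00's [B8] carrier RE-TYPED IN ONE FIELD (additive, «deprecate-and-add»): `zdGF3H` = n05-a's
# `B8LeafModelZd3.zdGF3` with Theorem 8's source space «`f ∈ R(U₀)`» read AS PRINTED — `f` a **Lie-algebra valued** (Hermitian) function
# **defined on Ω₀** (zero off it), from `R(U₀)` (`InR138`), with **finite** norm `|f|₍₋₂₎` (`B8ScaledSupNorm.Bdd`) — closing the two holes
# certified by `B8LeafModelZd3SourceReality` (p501857) and `B8LeafModelZd3SourceBounded` (seat n05-c g5); every other field is `zdGF3`'s by `rfl`,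
# so all landed Lemma 1 ∕ Thm 2 ∕ Prop 3 ∕ Thm 4 ∕ Props 5–7 instances at `zdGF3` transfer VERBATIM

statement-level skeleton of published theorems with citation tags; proofs where landed; nothing here is a claim about the
Yang–Mills mass gap

T. Bałaban, *Spaces of regular gauge field configurations on a lattice and gauge fixing conditions*, Commun. Math. Phys. **99** (1985)
75–102 `[Balaban1985RegularSpaces]` ("B8"; journal page = PDF page + 74; PDF held `paper:balaban1985-cmp99-regular-spaces-gauge-fixing`).
p. 101 [PDF 27]: *"R(U₀)D^{η*}_{U₀}A = f, (1.146) where f is a function from the space R(U₀), i.e. a Lie algebra valued function defined on Ω₀ and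
satisfying R(U₀)f = f … |f|₍₋₂₎ < γ(α₀ + α₁)"*; p. 80 (1.27) «L²(Ω₀, 𝔤) … real Hilbert space»; p. 86 (after (1.55)) «|A|_(α) = sup_j sup_{Ω_j}
(Lʲη)^{−α}|A|» (a maximum over the finite torus `T_η`).

## WHY THIS FILE (cell `pub-ymgap`, HUMAN RULING D-0062; R134 seat `pub-ymgap-dag-n05-c` g5, DAG node N05 = [B8]; definition lane, count-neutral)

`zdGF3` types Theorem 8's sources as `Src := Site d → 𝔸`, `InR U₀ f := InR138 …` (ℂ-linear) with `fNorm := msup … (−2)` (a real `iSup`, junk `0`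
on unbounded families).  The two located negatives of this seat show that BOTH omissions make `B8Thm8Surviving.Thm8SurvivingAt γ B₁ B₂` FALSE at
the record families: `not_b8LeafOfRecordSubB` (non-Hermitian `I•Δλ₀`) and `thm8Surviving_fails_hermitian_unbounded_source` (a Hermitian but
unbounded dipole train of «norm 0»).  An in-place edit of `zdGF3` is not fileable (those negatives import it), so the repair is ADDITIVE: a new
carrier `zdGF3H` differing from `zdGF3` in the ONE field `InR`, now the four-clause reading
`InR138 … f ∧ (∀ x, IsSelfAdjoint (f x)) ∧ (∀ x ∉ Ω₀, f x = 0) ∧ Bdd L k η (−2) (· ∈ Ω ·) f`.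
Because `InR` is a field of the extension `GFData3` itself, `(zdGF3H …).toGFData2 = (zdGF3 …).toGFData2` holds by `rfl`: every typed leaf that
reads `toGFData`∕`toGFData2` (Lemma 1 carriers apart: Thm 2, Prop 3, Thm 4) and every `GFData3` field except `InR` (`C140`, Prop. 7) is LITERALLY
the same proposition at `zdGF3H` as at `zdGF3` — §2 records the exemplary transfers by `exact`.  The pins of record (`Node00.famB8OfRecord := zdGF3 ∘
val` and its sub-families) are NODE 00's; this file only supplies the carrier and states what a re-pin `famB8OfRecordH := zdGF3H ∘ val` inherits.

## WHAT IS DECLARED ∕ PROVED (kernel, 0 sorry; axioms `propext` ∕ `Classical.choice` ∕ `Quot.sound`)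

* §1 **`zdGF3H 𝔸 L β len i`** (definition) and the `rfl` faces `zdGF3H_toGFData2`, `zdGF3H_toGFData`, `zdGF3H_C140`, `zdGF3H_LandauF`,
  `zdGF3H_fNorm`, `zdGF3H_fGrad`, `zdGF3H_Src`, `inR_zdGF3H_iff` (the four clauses), `inR_zdGF3_of_inR_zdGF3H` (OLD ⇐ NEW: the new membership
  implies the old).
* §2 transfers BY `exact`: `thm4Printed_zd3H` (n05-a's Theorem 4 instance, same sockets), `prop3Printed_zd3H` (n05-a's Proposition 3 instance).
* §3 the two refuting sources are REJECTED by the new membership: `not_inR_zdGF3H_of_not_isSelfAdjoint` (any `f` with a non-Hermitian value —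
  e.g. p501857's `I•Δλ₀` at a site where `Δλ₀ ≠ 0`), `bdd_of_inR_zdGF3H` ∕ `not_inR_zdGF3H_of_not_bdd` (unbounded weighted families — p503878's
  train); and `inR_zdGF3H_zero` (non-vacuity: `f = 0` is admitted).

## HONEST SCOPE

A definition + `rfl` bookkeeping; no estimate; nothing of [Balaban1985RegularSpaces] asserted beyond the landed instances it re-exports; whether
Theorem 8's surviving form HOLDS at `zdGF3H` is exactly the N05 `t8` question (this seat's `B8Thm8SurvivingZd3H` reduces it to the five sourced
sockets with the repaired source premiss).  Count-neutral; N05 NOT discharged; `T_η ↦ ℤᵈ`, `G = U(𝔸)`; one finite `T⁴` programme at fixed `ε`,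
Bałaban as printed — nothing continuum ∕ ℝ⁴ ∕ OS ∕ mass-gap ∕ Clay.  No `sorry`, no `instance`, no `notation`.  Unit `pub-ymgap-dag-n05-c` (g5),
2026-08-27.

[cite: Balaban1985RegularSpaces, Thm 8 (1.146) p.101 («Lie algebra valued function defined on Ω₀»), (1.27) p.80, p.86 (definition after (1.55)),
Thm 4 p.88, Prop. 3 p.87, (1.33)–(1.40) pp.82–83, (1.62) p.87, (1.66) p.88, (1.140) p.100]
-/

noncomputable section

open NormedSpace

namespace Literature.MathematicalPhysics.QuantumFieldTheory.Balaban1983to89.B8LeafModelZd3H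

open B7Prop2Explicit (unitaryUnits)
open B8Eq138LandauZd (InR138 IsLandau146W inR138_zero)
open B8ScaledSupNorm (msup weight Bdd)
open B8LeafModelZd (SockP5base SockP5 SockH59 SockP5u ZdIdx)
open B8LeafModelZd3 (zdGF3 SockB9P3 thm4Printed_zd3 prop3Printed_zd3)

-- `Site` alone could resolve to the torus sites of `Setup.lean`; re-export the `ℤ^d` sites of `B7Prop1Explicit`.
export B7Prop1Explicit (Site)

variable {d : ℕ}

/-! ## §1 The re-typed carrier `zdGF3H` and its `rfl` faces -/

section Family

variable (𝔸 : Type) [CStarAlgebra 𝔸] (L : ℕ) (β : ℝ) (len : Site d → ℝ)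

/-- **NODE 00's [B8] member with Theorem 8's source space read as printed**: n05-a's `zdGF3 𝔸 L β len i` with the ONE field `InR` replaced by
«`f` is a Lie-algebra valued (Hermitian) function defined on `Ω₀` (zero off it), from `R(U₀)` (`InR138`), with finite `|f|₍₋₂₎`
(`B8ScaledSupNorm.Bdd`)»; all other fields verbatim (hence `rfl`-equal). [cite: Balaban1985RegularSpaces, Thm 8 (1.146) p.101, (1.27) p.80, p.86 (definition after (1.55))] -/
def zdGF3H (i : ZdIdx d L) : B8SectGH.GFData3 :=
  { zdGF3 𝔸 L β len i with
    InR := fun U₀ f => InR138 L i.k i.η (i.Ω 0) (i.Λs i.k) U₀.1 f ∧ (∀ x, IsSelfAdjoint (f x)) ∧ (∀ x, x ∉ i.Ω 0 → f x = 0) ∧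
      Bdd L i.k i.η (-(2 : ℝ)) (fun j (x : Site d) => x ∈ i.Ω j) f }

variable {𝔸 L β len}

/-- The `GFData2` part (Lemma 1 – Prop. 6 carriers and predicates) of `zdGF3H` IS `zdGF3`'s (`rfl`). [cite: Balaban1985RegularSpaces, (1.33)–(1.40) pp.82–83 (bookkeeping)] -/
theorem zdGF3H_toGFData2 (i : ZdIdx d L) : (zdGF3H 𝔸 L β len i).toGFData2 = (zdGF3 𝔸 L β len i).toGFData2 := rfl

/-- The `GFData` part of `zdGF3H` IS `zdGF3`'s (`rfl`). [cite: Balaban1985RegularSpaces, (1.33)–(1.39) p.82 (bookkeeping)] -/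
theorem zdGF3H_toGFData (i : ZdIdx d L) : (zdGF3H 𝔸 L β len i).toGFData = (zdGF3 𝔸 L β len i).toGFData := rfl

/-- The source carrier is unchanged: `Src = (Site d → 𝔸)` (`rfl`). [cite: Balaban1985RegularSpaces, (1.146) p.101 (bookkeeping)] -/
theorem zdGF3H_Src (i : ZdIdx d L) : (zdGF3H 𝔸 L β len i).Src = (Site d → 𝔸) := rfl

/-- (1.140) is unchanged (`rfl`). [cite: Balaban1985RegularSpaces, (1.140) p.100 (bookkeeping)] -/
theorem zdGF3H_C140 (i : ZdIdx d L) : (zdGF3H 𝔸 L β len i).C140 = (zdGF3 𝔸 L β len i).C140 := rfl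

/-- (1.146) `LandauF` is unchanged (`rfl`). [cite: Balaban1985RegularSpaces, (1.146) p.101 (bookkeeping)] -/
theorem zdGF3H_LandauF (i : ZdIdx d L) : (zdGF3H 𝔸 L β len i).LandauF = (zdGF3 𝔸 L β len i).LandauF := rfl

/-- `|f|₍₋₂₎` is unchanged (`rfl`). [cite: Balaban1985RegularSpaces, p.86 (definition after (1.55)) (bookkeeping)] -/
theorem zdGF3H_fNorm (i : ZdIdx d L) : (zdGF3H 𝔸 L β len i).fNorm = (zdGF3 𝔸 L β len i).fNorm := rfl

/-- `|D f|₍₋₃₎` is unchanged (`rfl`). [cite: Balaban1985RegularSpaces, p.86 (definition after (1.55)) (bookkeeping)] -/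
theorem zdGF3H_fGrad (i : ZdIdx d L) : (zdGF3H 𝔸 L β len i).fGrad = (zdGF3 𝔸 L β len i).fGrad := rfl

/-- **The four clauses of the re-typed membership «`f ∈ R(U₀)`»** (unfolding). [cite: Balaban1985RegularSpaces, Thm 8 (1.146) p.101, (1.27) p.80, p.86] -/
theorem inR_zdGF3H_iff (i : ZdIdx d L) (U₀ : (zdGF3H 𝔸 L β len i).Cfg) (f : Site d → 𝔸) :
    (zdGF3H 𝔸 L β len i).InR U₀ f ↔
      InR138 L i.k i.η (i.Ω 0) (i.Λs i.k) U₀.1 f ∧ (∀ x, IsSelfAdjoint (f x)) ∧ (∀ x, x ∉ i.Ω 0 → f x = 0) ∧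
        Bdd L i.k i.η (-(2 : ℝ)) (fun j (x : Site d) => x ∈ i.Ω j) f :=
  Iff.rfl

/-- OLD ⇐ NEW: the re-typed membership implies `zdGF3`'s (`InR138` is its first clause). [cite: Balaban1985RegularSpaces, (1.146) p.101 (bookkeeping)] -/
theorem inR_zdGF3_of_inR_zdGF3H (i : ZdIdx d L) (U₀ : (zdGF3H 𝔸 L β len i).Cfg) (f : Site d → 𝔸)
    (h : (zdGF3H 𝔸 L β len i).InR U₀ f) : (zdGF3 𝔸 L β len i).InR U₀ f :=
  h.1

end Family

/-! ## §2 The landed abstract-leaf instances transfer by `exact` -/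

section Transfer

variable {𝔸 : Type} [CStarAlgebra 𝔸] [Nontrivial 𝔸]

/-- **THEOREM 4 at `zdGF3H`** = n05-a's `B8LeafModelZd3.thm4Printed_zd3` verbatim (the typed leaf reads `toGFData`, which is `zdGF3`'s by `rfl`):
modulo the four member-wise sockets. [cite: Balaban1985RegularSpaces, Thm 4 p.88] -/
theorem thm4Printed_zd3H (hd2 : 2 ≤ d) {L : ℕ} (hL : 2 ≤ L) {β : ℝ} {len : Site d → ℝ} {B₀ B₀' cu cP : ℝ} (hB₀ : 0 < B₀)
    (hB₀' : 0 < B₀') (hB : 2 ≤ 5 * (d : ℝ) * L * B₀) (hcu : 0 < cu) (hcP : 0 < cP)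
    (SP5base : ∀ i : ZdIdx d L, SockP5base (𝔸 := 𝔸) L B₀ B₀' cP i.η i.k i.Ω i.Λs)
    (SP5 : ∀ i : ZdIdx d L, SockP5 (𝔸 := 𝔸) L B₀ B₀' cP i.η i.k i.Ω i.Λs)
    (SH59 : ∀ i : ZdIdx d L, SockH59 (𝔸 := 𝔸) L B₀ B₀' cP i.η i.k i.Ω i.Λs i.Λb)
    (SP5u : ∀ i : ZdIdx d L, SockP5u (𝔸 := 𝔸) L cP cu i.η i.k i.Ω i.Λs) :
    B8.Thm4Printed (5 * (d : ℝ) * L * B₀) (fun i : ZdIdx d L => (zdGF3H 𝔸 L β len i).toGFData) :=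
  thm4Printed_zd3 hd2 hL hB₀ hB₀' hB hcu hcP SP5base SP5 SH59 SP5u

/-- **PROPOSITION 3 at `zdGF3H`** = n05-a's `B8LeafModelZd3.prop3Printed_zd3` verbatim (the typed leaf reads `toGFData2`, `rfl`-equal): modulo the
Prop.-3-frame b9 socket. [cite: Balaban1985RegularSpaces, Prop. 3 p.87] -/
theorem prop3Printed_zd3H (hd2 : 2 ≤ d) {L : ℕ} (hL : 2 ≤ L) (inp : B8.B9Inputs) {B₀β C₂ cP : ℝ} (hB₀β : 0 ≤ B₀β)
    (hC₂ : 2097152 * ((d : ℝ) + 1) ^ 2 ≤ C₂) (hcP : 0 < cP) (β : ℝ) (len : Site d → ℝ)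
    (SB9 : ∀ i : ZdIdx d L, SockB9P3 (𝔸 := 𝔸) L inp.B₀ B₀β cP β len i.η i.k i.Ω i.Λs i.Λb) :
    B8.Prop3Printed d (L : ℝ) C₂ inp B₀β (fun i : ZdIdx d L => (zdGF3H 𝔸 L β len i).toGFData2) :=
  prop3Printed_zd3 hd2 hL inp hB₀β hC₂ hcP β len SB9

end Transfer

/-! ## §3 The two refuting sources are rejected; `f = 0` is admitted -/

section Rejected

variable {𝔸 : Type} [CStarAlgebra 𝔸] {L : ℕ} {β : ℝ} {len : Site d → ℝ}

/-- **A source with a non-Hermitian value is NOT admitted** (p501857's `I•Δλ₀` has `I•κ•1`-type values, `κ ≠ 0`).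
[cite: Balaban1985RegularSpaces, Thm 8 (1.146) p.101 («Lie algebra valued»)] -/
theorem not_inR_zdGF3H_of_not_isSelfAdjoint (i : ZdIdx d L) (U₀ : (zdGF3H 𝔸 L β len i).Cfg) {f : Site d → 𝔸} {x : Site d}
    (hx : ¬ IsSelfAdjoint (f x)) : ¬ (zdGF3H 𝔸 L β len i).InR U₀ f := fun h => hx (h.2.1 x)

/-- **An admitted source has a bounded weighted family** (so `|f|₍₋₂₎ = msup` is its true supremum, `B8ScaledSupNorm.weight_mul_norm_le_msup`).
[cite: Balaban1985RegularSpaces, p.86 (definition after (1.55))] -/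
theorem bdd_of_inR_zdGF3H (i : ZdIdx d L) (U₀ : (zdGF3H 𝔸 L β len i).Cfg) {f : Site d → 𝔸} (h : (zdGF3H 𝔸 L β len i).InR U₀ f) :
    Bdd L i.k i.η (-(2 : ℝ)) (fun j (x : Site d) => x ∈ i.Ω j) f :=
  h.2.2.2

/-- **An unbounded source is NOT admitted** (p503878's dipole train `λ_∞` has `‖f(aₙ)‖ = n(2d+1)η⁻²`). [cite: Balaban1985RegularSpaces, p.86 (definition after (1.55))] -/
theorem not_inR_zdGF3H_of_not_bdd (i : ZdIdx d L) (U₀ : (zdGF3H 𝔸 L β len i).Cfg) {f : Site d → 𝔸}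
    (hf : ¬ Bdd L i.k i.η (-(2 : ℝ)) (fun j (x : Site d) => x ∈ i.Ω j) f) : ¬ (zdGF3H 𝔸 L β len i).InR U₀ f :=
  fun h => hf h.2.2.2

/-- **Non-vacuity of the re-typed membership: `f = 0 ∈ R(U₀)`** (`InR138` by `inR138_zero`; `0` Hermitian, supported anywhere, bounded by `0`).
[cite: Balaban1985RegularSpaces, (1.146) p.101 (f = 0 is (1.38))] -/
theorem inR_zdGF3H_zero (i : ZdIdx d L) (U₀ : (zdGF3H 𝔸 L β len i).Cfg) : (zdGF3H 𝔸 L β len i).InR U₀ (0 : Site d → 𝔸) := by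
  refine ⟨inR138_zero (η := i.η) (U₀ := U₀.1) L i.k _ _, fun _ => by simp, fun _ _ => rfl, ⟨0, fun j _ x _ => by simp⟩⟩

end Rejected

#print axioms thm4Printed_zd3H

end Literature.MathematicalPhysics.QuantumFieldTheory.Balaban1983to89.B8LeafModelZd3H

end
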